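import Summits.AnomalousDissipation.AnomalousDissipation.Theorems.BaireTransferDenseLoudDesignerForcesErgodicWeakDuhamel
import Literature.Analysis.FluidPDE.StokesTorusFrameBound
import Literature.Analysis.FluidPDE.TorusClassicalH1Balance
import Literature.Analysis.UnboundedOperators.WeaklySingularDuhamel
import Literature.Analysis.FunctionSpaces.TorusClassicalNSGluing

/-!
# A classical trajectory read in the frame `S = (1 + A)^{-1/2}` solves the strong mild equation
# (line `ergodic-budget-selection-closing`, crux `BaireTransfer.DenseLoudDesignerForces`,
# stmt-AnomalousDissipation-1143) — tools stub S5b of block N-R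

Sorry-free file over the landed vocabulary `…ErgodicLine.lean` (`Hsp = Torus.energySpace (Fin 3)`, `rep`),
`…ErgodicPeriodicOrbitA.lean` (`stateOf`, `rep_stateOf`, `norm_stateOf_sub_sq`), `…ErgodicWeakDuhamel.lean` (S5:
`inner_stateOf_left`), the modewise Duhamel formula of a classical Navier–Stokes solution
`Torus.IsClassicalNSSolutionOn.integral_inner_eq_exp_mul_add_integral` (`TorusClassicalNSModeDuhamel.lean`), the
coefficient formula of a diagonal operator `Torus.repr_apply_of_apply_basis` (`StokesTorusFrameBound.lean`) and the
integrability of weakly singular Duhamel integrands (`WeaklySingularDuhamel.lean`).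

Block N-R of the line constructs the smooth model of an NS phase as the mild flow, in the frame
`S = diag((1 + m)^{-1/2})` of the Stokes eigenbasis `b` (`(b i : L²) = stokesModeL2 k a c`, `m i = 4π²|k|²`), of
`y(t) = T(νt) y₀ + ∫₀ᵗ T(ν(t − s)) x_F ds − ∫₀ᵗ K(ν(t − s)) Nb(y(s), y(s)) ds` with the Stokes semigroup
`T t = diag(e^{-tm})`, the smoothing family `K t = diag(m^{3/4} e^{-tm})` and the bilinear form `Nb` of S3
(`⟪Nb y z, b i⟫ = −m_i^{-3/4} (1 + m_i)^{1/2} ∫⟪S z, ((S y)·∇)φ_i⟫`).  This file proves that the FRAME CURVE `y` of a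
classical trajectory, `S (y t) = [u(a₀ + t)]`, solves exactly this equation (`stub_conjugatedMildIdentityTools`, the
REGISTERED tools stub S5b), through:

* `inner_basis_apply_of_apply_basis` — `⟪b i, L z⟫ = σ i ⟪b i, z⟫` for a bounded `L` acting diagonally on `b`;
* `inner_stateOf_right_of_coe_eq`, `inner_stateOf_laplacian_right_of_coe_eq` — the coefficients
  `⟪h, [v]⟫ = ∫⟪v, φ⟫`, `⟪h, [Δv]⟫ = −4π²|k|² ∫⟪v, φ⟫` of honest states along a state `h` represented by a Stokes mode `φ`;
* `eq_frame_apply_of_frame_apply_eq_stateOf` — the frame preimage of an honest state: `S z = [v]` forces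
  `z = S ([v] − [Δv])` (coefficientwise `(1 + m)^{1/2} c = (1 + m)^{-1/2} (c + m c)`);
* `continuousOn_stateOf_of_isSmoothSpaceTimeOn`, `continuousOn_frameCurve` — state curves of jointly smooth honest
  fields are continuous in `H`, hence so is the frame curve `y = S([u] − [Δu])(a₀ + ·)` on the window, which makes
  the Duhamel integrands Bochner integrable (`intervalIntegrable_duhamelIntegrand`, exponents `0` and `3/4`);
* `inner_basis_frameCurve_eq_inner_basis_mild` — coefficientwise the identity is `(1 + m_i)^{1/2}` times the modewise
  Duhamel formula: `⟪b i, y t⟫ = (1 + m_i)^{1/2} ∫⟪u(a₀ + t), φ_i⟫`, `⟪b i, T r z⟫ = e^{-r m_i} ⟪b i, z⟫` (`T r`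
  self-adjoint), `⟪b i, K r z⟫ = m_i^{3/4} e^{-r m_i} ⟪b i, z⟫`, `rep (S (y s)) = u(a₀ + s)` a.e. in the coefficient
  formula of `Nb`, `⟪b i, ∫⟫ = ∫⟪b i, ·⟫` (`integral_inner`) and the change of variables `s ↦ a₀ + s`;
* `stub_conjugatedMildIdentityTools` — vectors with equal basis coefficients are equal (`b.repr` is injective).

References: P. Constantin, C. Foias, *Navier–Stokes Equations* (Chicago 1988), Ch. 5 (5.9)–(5.10), Ch. 6 (6.9)–(6.10)
(the mild form and its bilinear term), Ch. 4 (4.11)–(4.13) (`V = D(A^{1/2})`); D. Henry, *Geometric Theory of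
Semilinear Parabolic Equations* (1981), §3.3.  Nothing is asserted; no definition is added.
-/

-- `Summit.<Summit>.<Problem>` is the tree's mandated summit-side namespace (CONVENTIONS §2); for this
-- single-conjunct summit the two coincide, so the duplicate is deliberate.
set_option linter.dupNamespace false

noncomputable section

open Set Function MeasureTheory Filter
open scoped InnerProductSpace RealInnerProductSpace Topology

namespace Summit.AnomalousDissipation.AnomalousDissipation.Theorems.DenseLoudDesignerForces.Ergodic

open Literature.Analysis.FunctionSpaces Literature.Analysis.FunctionSpaces.Torus
open Literature.Analysis.FluidPDE Literature.Analysis.FluidPDE.Torus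

/-! ## Coefficients of diagonal operators and of honest states along Stokes modes -/

/-- A bounded operator acting diagonally on a Hilbert basis, `L (b i) = σ i • b i`, has coefficients
`⟪b i, L z⟫ = σ i ⟪b i, z⟫` (`Torus.repr_apply_of_apply_basis`; Halmos, *A Hilbert Space Problem Book*, Problem 61).
[folklore] -/
theorem inner_basis_apply_of_apply_basis {ι E : Type*} [NormedAddCommGroup E] [InnerProductSpace ℝ E]
    [CompleteSpace E] (b : HilbertBasis ι ℝ E) {σ : ι → ℝ} {L : E →L[ℝ] E} (hL : ∀ i, L (b i) = σ i • b i)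
    (z : E) (i : ι) : ⟪b i, L z⟫_ℝ = σ i * ⟪b i, z⟫_ℝ := by
  rw [← b.repr_apply_apply, ← b.repr_apply_apply]
  exact repr_apply_of_apply_basis b σ L hL z i

/-- The coefficient of an honest state along a state represented by a Stokes mode: if `(h : L²) = stokesModeL2 k a c`
then `⟪h, [v]⟫ = ∫⟪v, φ⟫` with `φ = stokesMode k a c` (`inner_stateOf_left`, `rep h = φ` a.e.). [folklore] -/
theorem inner_stateOf_right_of_coe_eq {v : (UnitAddTorus (Fin 3)) → (EuclideanSpace ℝ (Fin 3))} (hv : IsSmooth v)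
    (hd : IsDivFree v) (hm : HasZeroMean v) {h : Hsp} {k : Fin 3 → ℤ} {a : EuclideanSpace ℝ (Fin 3)} {c : Bool}
    (hh : ((h : Hsp) : Lp (EuclideanSpace ℝ (Fin 3)) 2 (volume : Measure (UnitAddTorus (Fin 3)))) = stokesModeL2 k a c) :
    ⟪h, stateOf v⟫_ℝ = ∫ x, ⟪v x, stokesMode k a c x⟫_ℝ := by
  rw [real_inner_comm (stateOf v) h, inner_stateOf_left hv hd hm]
  have hrep : rep h =ᵐ[volume] ⇑(stokesMode k a c) := by
    show (((h : Hsp) : Lp (EuclideanSpace ℝ (Fin 3)) 2 (volume : Measure (UnitAddTorus (Fin 3)))) :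
        (UnitAddTorus (Fin 3)) → (EuclideanSpace ℝ (Fin 3))) =ᵐ[volume] _
    rw [hh]
    exact coeFn_stokesModeL2 k a c
  refine integral_congr_ae ?_
  filter_upwards [hrep] with x hx
  rw [hx]

/-- The coefficient of the Laplacian of an honest field along a Stokes mode state: `⟪h, [Δv]⟫ = −4π²|k|² ∫⟪v, φ⟫`
(`Δv` is smooth, divergence free and mean zero; Green's identity `∫⟪Δv, φ⟫ = ∫⟪v, Δφ⟫` and `Δφ = −4π²|k|² φ`).
[folklore] -/
theorem inner_stateOf_laplacian_right_of_coe_eq {v : (UnitAddTorus (Fin 3)) → (EuclideanSpace ℝ (Fin 3))}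
    (hv : IsSmooth v) (hd : IsDivFree v) {h : Hsp} {k : Fin 3 → ℤ} {a : EuclideanSpace ℝ (Fin 3)} {c : Bool}
    (hh : ((h : Hsp) : Lp (EuclideanSpace ℝ (Fin 3)) 2 (volume : Measure (UnitAddTorus (Fin 3)))) = stokesModeL2 k a c) :
    ⟪h, stateOf (laplacian v)⟫_ℝ = -(stokesEigenvalue k * ∫ x, ⟪v x, stokesMode k a c x⟫_ℝ) := by
  rw [inner_stateOf_right_of_coe_eq hv.laplacian (IsDivFree.laplacian_of_isSmooth hv hd)
    (integral_laplacian_eq_zero_of_isSmooth hv) hh, Torus.integral_inner_laplacian_comm hv (isSmooth_stokesMode k a c)]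
  have hpt : (fun x => ⟪v x, laplacian ⇑(stokesMode k a c) x⟫_ℝ) =
      fun x => -stokesEigenvalue k * ⟪v x, stokesMode k a c x⟫_ℝ := by
    funext x
    rw [laplacian_stokesMode, real_inner_smul_right]
  rw [hpt, integral_const_mul, neg_mul]

/-! ## The frame preimage of an honest state and the continuity of state curves -/

/-- **The frame preimage of an honest state.**  On a Hilbert basis of Stokes modes with `S (b i) = (1 + m i)^{-1/2} b i`
(`S = (1 + A)^{-1/2}`), if `S z = [v]` for a smooth divergence-free mean-zero `v` then `z = S ([v] − [Δv])`
(`= S (1 + A) [v]`): coefficientwise `⟪b i, z⟫ = (1 + m i)^{1/2} ∫⟪v, φ_i⟫ = (1 + m i)^{-1/2} (1 + m i) ∫⟪v, φ_i⟫`, and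
`b.repr` is injective (Constantin–Foias 1988, Ch. 4 (4.11)–(4.13): `S⁻¹ = (1 + A)^{1/2}` on `D(A)`). [folklore] -/
theorem eq_frame_apply_of_frame_apply_eq_stateOf {ι : Type*} (b : HilbertBasis ι ℝ Hsp) {m : ι → ℝ}
    (hb : ∀ i, ∃ (k : Fin 3 → ℤ) (a : EuclideanSpace ℝ (Fin 3)) (c : Bool), k ≠ 0 ∧ a ≠ 0 ∧ ⟪latticeVec k, a⟫_ℝ = 0 ∧
      ((b i : Hsp) : Lp (EuclideanSpace ℝ (Fin 3)) 2 (volume : Measure (UnitAddTorus (Fin 3)))) = stokesModeL2 k a c ∧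
      m i = stokesEigenvalue k)
    {S : Hsp →L[ℝ] Hsp} (hS : ∀ i, S (b i) = ((1 + m i) ^ (-(1 / 2 : ℝ))) • b i)
    {v : (UnitAddTorus (Fin 3)) → (EuclideanSpace ℝ (Fin 3))} (hv : IsSmooth v) (hd : IsDivFree v) (hm : HasZeroMean v)
    {z : Hsp} (hz : S z = stateOf v) : z = S (stateOf v - stateOf (laplacian v)) := by
  apply b.repr.injective
  ext i
  obtain ⟨k, a, c, -, -, -, hbi, hmi⟩ := hb i
  have h1 : 0 < 1 + m i := by
    have h0 : 0 ≤ m i := hmi ▸ stokesEigenvalue_nonneg k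
    linarith
  have hσsq : (1 + m i) * ((1 + m i) ^ (-(1 / 2 : ℝ)) * (1 + m i) ^ (-(1 / 2 : ℝ))) = 1 := by
    rw [← Real.rpow_add h1, show -(1 / 2 : ℝ) + -(1 / 2 : ℝ) = -1 by norm_num, Real.rpow_neg_one,
      mul_inv_cancel₀ h1.ne']
  have hσ0 : (1 + m i) ^ (-(1 / 2 : ℝ)) ≠ 0 := (Real.rpow_pos_of_pos h1 _).ne'
  -- the coefficient of `z`: `(1 + m i)^{-1/2} ⟪b i, z⟫ = ∫⟪v, φ⟫`
  have hcoef := inner_basis_apply_of_apply_basis b hS z i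
  rw [hz, inner_stateOf_right_of_coe_eq hv hd hm hbi] at hcoef
  rw [b.repr_apply_apply, b.repr_apply_apply, inner_basis_apply_of_apply_basis b hS _ i, inner_sub_right,
    inner_stateOf_right_of_coe_eq hv hd hm hbi, inner_stateOf_laplacian_right_of_coe_eq hv hd hbi, ← hmi]
  apply mul_left_cancel₀ hσ0
  rw [← hcoef]
  linear_combination (-(∫ x, ⟪v x, stokesMode k a c x⟫_ℝ)) * hσsq

/-- **State curves of jointly smooth honest fields are continuous in `H`** (within the time set): for `v` jointly
smooth on `U × T³` with divergence-free mean-zero slices, `s ↦ [v s]` is continuous on `U` (uniform-in-space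
continuity in time, `IsSmoothSpaceTimeOn.eventually_norm_sub_lt`, and `‖[v s] − [v s']‖² = ∫‖v s − v s'‖²`). [folklore] -/
theorem continuousOn_stateOf_of_isSmoothSpaceTimeOn {U : Set ℝ} {v : ℝ → (UnitAddTorus (Fin 3)) → (EuclideanSpace ℝ (Fin 3))}
    (hv : IsSmoothSpaceTimeOn U v) (hd : ∀ s ∈ U, IsDivFree (v s)) (hm : ∀ s ∈ U, HasZeroMean (v s)) :
    ContinuousOn (fun s => stateOf (v s)) U := by
  have hsm : ∀ s ∈ U, IsSmooth (v s) := fun s hs => hv.isSmooth_slice hs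
  intro t₀ ht₀
  rw [ContinuousWithinAt, Metric.tendsto_nhds]
  intro ε hε
  obtain ⟨η, hη, hηε⟩ : ∃ η : ℝ, 0 < η ∧ η ^ 2 < ε ^ 2 := ⟨ε / 2, by positivity, by nlinarith⟩
  filter_upwards [hv.eventually_norm_sub_lt ht₀ hη, self_mem_nhdsWithin] with s hs hsU
  rw [dist_eq_norm]
  have hsq : ‖stateOf (v s) - stateOf (v t₀)‖ ^ 2 < ε ^ 2 := by
    rw [norm_stateOf_sub_sq (hsm s hsU) (hd s hsU) (hm s hsU) (hsm t₀ ht₀) (hd t₀ ht₀) (hm t₀ ht₀)]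
    calc ∫ x, ‖v s x - v t₀ x‖ ^ 2 ≤ ∫ _ : UnitAddTorus (Fin 3), η ^ 2 := by
          refine integral_mono_of_nonneg (Eventually.of_forall fun x => sq_nonneg _) (integrable_const _)
            (Eventually.of_forall fun x => ?_)
          exact pow_le_pow_left₀ (norm_nonneg _) (hs x).le 2
      _ = η ^ 2 := by simp
      _ < ε ^ 2 := hηε
  exact (abs_lt_of_sq_lt_sq' hsq hε.le).2

  -- coefficients of the diagonal operators `S`, `T r` (self-adjoint), `K r` along `b i`
/-! ## The frame curve of a classical trajectory -/

/-- **The frame curve of a classical trajectory is continuous.**  If `S (y t) = [u(a₀ + t)]` on `[0, τ']` for a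
classical solution `u` with mean-zero slices on `[a₀, a₀ + τ'] × T³` and the frame `S = diag((1 + m)^{-1/2})` of a
Stokes mode basis, then `y` is continuous on `[0, τ']`: `y t = S ([u] − [Δu])(a₀ + t)`
(`eq_frame_apply_of_frame_apply_eq_stateOf`) and the state curves of the jointly smooth honest fields `u`, `Δu` are
continuous (`continuousOn_stateOf_of_isSmoothSpaceTimeOn`) — the `V`-continuity of strong solutions
(Constantin–Foias 1988, Ch. 4 (4.11)–(4.13) and Thm. 10.6). [folklore] -/
theorem continuousOn_frameCurve {ι : Type*} (b : HilbertBasis ι ℝ Hsp) {m : ι → ℝ}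
    (hb : ∀ i, ∃ (k : Fin 3 → ℤ) (a : EuclideanSpace ℝ (Fin 3)) (c : Bool), k ≠ 0 ∧ a ≠ 0 ∧ ⟪latticeVec k, a⟫_ℝ = 0 ∧
      ((b i : Hsp) : Lp (EuclideanSpace ℝ (Fin 3)) 2 (volume : Measure (UnitAddTorus (Fin 3)))) = stokesModeL2 k a c ∧
      m i = stokesEigenvalue k)
    {S : Hsp →L[ℝ] Hsp} (hS : ∀ i, S (b i) = ((1 + m i) ^ (-(1 / 2 : ℝ))) • b i)
    {ν : ℝ} {F : (UnitAddTorus (Fin 3)) → (EuclideanSpace ℝ (Fin 3))} {a₀ τ' : ℝ} (hτ' : 0 < τ')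
    {u : ℝ → (UnitAddTorus (Fin 3)) → (EuclideanSpace ℝ (Fin 3))} {p : ℝ → (UnitAddTorus (Fin 3)) → ℝ}
    (hsol : IsClassicalNSSolutionOn (Icc a₀ (a₀ + τ')) ν (fun _ => F) u p) (hmean : ∀ t ∈ Icc a₀ (a₀ + τ'), HasZeroMean (u t))
    {y : ℝ → Hsp} (hy : ∀ t ∈ Icc (0 : ℝ) τ', S (y t) = stateOf (u (a₀ + t))) : ContinuousOn y (Icc 0 τ') := by
  have hU : UniqueDiffOn ℝ (Icc a₀ (a₀ + τ')) := uniqueDiffOn_Icc (by linarith)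
  have hu : IsSmoothSpaceTimeOn (Icc a₀ (a₀ + τ')) u := hsol.smooth_velocity
  have hus : ∀ s ∈ Icc a₀ (a₀ + τ'), IsSmooth (u s) := fun s hs => hu.isSmooth_slice hs
  have hI : ∀ s ∈ Icc (0 : ℝ) τ', a₀ + s ∈ Icc a₀ (a₀ + τ') := fun s hs =>
    ⟨by linarith [hs.1], by linarith [hs.2]⟩
  have hW : ContinuousOn (fun s => stateOf (u s) - stateOf (laplacian (u s))) (Icc a₀ (a₀ + τ')) :=
    (continuousOn_stateOf_of_isSmoothSpaceTimeOn hu hsol.divFree hmean).sub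
      (continuousOn_stateOf_of_isSmoothSpaceTimeOn (hu.laplacian hU)
        (fun s hs => IsDivFree.laplacian_of_isSmooth (hus s hs) (hsol.divFree s hs))
        (fun s hs => integral_laplacian_eq_zero_of_isSmooth (hus s hs)))
  have h1 : ContinuousOn (fun s => S (stateOf (u (a₀ + s)) - stateOf (laplacian (u (a₀ + s))))) (Icc 0 τ') :=
    S.continuous.comp_continuousOn (hW.comp (continuous_const.add continuous_id).continuousOn hI)
  refine h1.congr fun s hs => ?_
  exact eq_frame_apply_of_frame_apply_eq_stateOf b hb hS (hus _ (hI s hs)) (hsol.divFree _ (hI s hs))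
    (hmean _ (hI s hs)) (hy s hs)

/-- **The conjugated mild identity along one basis mode.**  In the setting of `stub_conjugatedMildIdentityTools`, with
both Duhamel integrands known to be integrable on `[0, t]`, the coefficient of the frame curve along `b i = [φ]`
(`φ = stokesMode k a c`, `m i = 4π²|k|²`) satisfies
`⟪b i, y t⟫ = ⟪b i, T(νt) y 0 + ∫₀ᵗ T(ν(t−s)) x_F ds − ∫₀ᵗ K(ν(t−s)) Nb(y s, y s) ds⟫`: with `ρ = (1 + m i)^{1/2}`,
`⟪b i, y s⟫ = ρ ∫⟪u(a₀+s), φ⟫`, `⟪b i, x_F⟫ = ρ ∫⟪F, φ⟫`, `⟪b i, T r z⟫ = e^{-r m_i}⟪b i, z⟫` (`T r` self-adjoint),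
`⟪b i, K r z⟫ = m_i^{3/4} e^{-r m_i}⟪b i, z⟫`, `⟪b i, Nb (y s) (y s)⟫ = −m_i^{-3/4} ρ ∫⟪u(a₀+s), (u(a₀+s)·∇)φ⟫`
(`rep (S (y s)) = u(a₀+s)` a.e.), `⟪b i, ∫⟫ = ∫⟪b i, ·⟫` (`integral_inner`), the identity is `ρ` times the modewise
Duhamel formula `IsClassicalNSSolutionOn.integral_inner_eq_exp_mul_add_integral` after `s ↦ a₀ + s`
(Constantin–Foias 1988, Ch. 5 (5.9)–(5.10)). [cite: ConstantinFoiasNSE1988, Ch. 5 (5.9)–(5.10)] -/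
theorem inner_basis_frameCurve_eq_inner_basis_mild {ι : Type*} (b : HilbertBasis ι ℝ Hsp) {m : ι → ℝ}
    (hpos : ∀ i, 0 < m i)
    (hb : ∀ i, ∃ (k : Fin 3 → ℤ) (a : EuclideanSpace ℝ (Fin 3)) (c : Bool), k ≠ 0 ∧ a ≠ 0 ∧ ⟪latticeVec k, a⟫_ℝ = 0 ∧
      ((b i : Hsp) : Lp (EuclideanSpace ℝ (Fin 3)) 2 (volume : Measure (UnitAddTorus (Fin 3)))) = stokesModeL2 k a c ∧
      m i = stokesEigenvalue k)
    {S : Hsp →L[ℝ] Hsp} (hS : ∀ i, S (b i) = ((1 + m i) ^ (-(1 / 2 : ℝ))) • b i)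
    {T K : ℝ → Hsp →L[ℝ] Hsp} (hT : ∀ t i, 0 ≤ t → T t (b i) = Real.exp (-(t * m i)) • b i)
    (hTsa : ∀ t, 0 ≤ t → IsSelfAdjoint (T t))
    (hK : ∀ t i, 0 < t → K t (b i) = ((m i) ^ (3 / 4 : ℝ) * Real.exp (-(t * m i))) • b i)
    {Nb : Hsp →L[ℝ] Hsp →L[ℝ] Hsp}
    (hNb : ∀ (y z : Hsp) (i : ι) (k : Fin 3 → ℤ) (a : EuclideanSpace ℝ (Fin 3)) (c : Bool),
      ((b i : Hsp) : Lp (EuclideanSpace ℝ (Fin 3)) 2 (volume : Measure (UnitAddTorus (Fin 3)))) = stokesModeL2 k a c →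
      ⟪Nb y z, b i⟫_ℝ = -((m i) ^ (-(3 / 4 : ℝ)) * (1 + m i) ^ (1 / 2 : ℝ)) *
        ∫ x, ⟪rep (S z) x, convect (rep (S y)) (stokesMode k a c) x⟫_ℝ)
    {ν : ℝ} (hν : 0 < ν) {F : (UnitAddTorus (Fin 3)) → (EuclideanSpace ℝ (Fin 3))} (hF : IsSmooth F) (hFdiv : IsDivFree F)
    (hFmean : HasZeroMean F) {a₀ τ' : ℝ} (hτ' : 0 < τ')
    {u : ℝ → (UnitAddTorus (Fin 3)) → (EuclideanSpace ℝ (Fin 3))} {p : ℝ → (UnitAddTorus (Fin 3)) → ℝ}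
    (hsol : IsClassicalNSSolutionOn (Icc a₀ (a₀ + τ')) ν (fun _ => F) u p) (hmean : ∀ t ∈ Icc a₀ (a₀ + τ'), HasZeroMean (u t))
    {y : ℝ → Hsp} (hy : ∀ t ∈ Icc (0 : ℝ) τ', S (y t) = stateOf (u (a₀ + t))) {xF : Hsp} (hxF : S xF = stateOf F)
    {t : ℝ} (ht : t ∈ Icc (0 : ℝ) τ') (hI1 : IntervalIntegrable (fun s => T (ν * (t - s)) xF) volume 0 t)
    (hI2 : IntervalIntegrable (fun s => K (ν * (t - s)) (Nb (y s) (y s))) volume 0 t) (i : ι) :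
    ⟪b i, y t⟫_ℝ = ⟪b i, T (ν * t) (y 0) + (∫ s in (0 : ℝ)..t, T (ν * (t - s)) xF) -
      ∫ s in (0 : ℝ)..t, K (ν * (t - s)) (Nb (y s) (y s))⟫_ℝ := by
  have ht0 : (0 : ℝ) ≤ t := ht.1
  have hus : ∀ s ∈ Icc a₀ (a₀ + τ'), IsSmooth (u s) := fun s hs => hsol.smooth_velocity.isSmooth_slice hs
  have hI : ∀ s ∈ Icc (0 : ℝ) τ', a₀ + s ∈ Icc a₀ (a₀ + τ') := fun s hs =>
    ⟨by linarith [hs.1], by linarith [hs.2]⟩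
  -- the mode `b i = [φ]`, `φ = stokesMode k a c`, `m i = 4π²|k|²`
  obtain ⟨k, a, c, -, -, hka, hbi, hmi⟩ := hb i
  have hφs : IsSmooth ⇑(stokesMode k a c) := isSmooth_stokesMode k a c
  have hφd : IsDivFree ⇑(stokesMode k a c) := isDivFree_stokesMode hka c
  have heig : ∀ x, laplacian ⇑(stokesMode k a c) x = -(stokesEigenvalue k • stokesMode k a c x) := fun x => by
    rw [laplacian_stokesMode, neg_smul]
  have hm0 : 0 < m i := hpos i
  have h1 : 0 < 1 + m i := by linarith
  obtain ⟨ρ, hρ⟩ : ∃ ρ : ℝ, ρ = (1 + m i) ^ (1 / 2 : ℝ) := ⟨_, rfl⟩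
  have hρ0 : ρ ≠ 0 := hρ ▸ (Real.rpow_pos_of_pos h1 _).ne'
  have hσρ : (1 + m i) ^ (-(1 / 2 : ℝ)) = ρ⁻¹ := hρ ▸ Real.rpow_neg h1.le _
  have hmm : (m i) ^ (3 / 4 : ℝ) * (m i) ^ (-(3 / 4 : ℝ)) = 1 := by
    rw [Real.rpow_neg hm0.le, mul_inv_cancel₀ (Real.rpow_pos_of_pos hm0 _).ne']
  have hSi : ∀ z : Hsp, ⟪b i, S z⟫_ℝ = ρ⁻¹ * ⟪b i, z⟫_ℝ := fun z => by
    rw [inner_basis_apply_of_apply_basis b hS z i, hσρ]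
  have hTi : ∀ r : ℝ, 0 ≤ r → ∀ z : Hsp, ⟪b i, T r z⟫_ℝ = Real.exp (-(r * m i)) * ⟪b i, z⟫_ℝ := fun r hr z => by
    have hsym := (hTsa r hr).isSymmetric (b i) z
    simp only [ContinuousLinearMap.coe_coe] at hsym
    have hsm := inner_smul_left (𝕜 := ℝ) (E := Hsp) (b i) z (Real.exp (-(r * m i)))
    rw [conj_trivial] at hsm
    rw [← hsym, hT r i hr]
    exact hsm
  have hKi : ∀ r : ℝ, 0 < r → ∀ z : Hsp,
      ⟪b i, K r z⟫_ℝ = ((m i) ^ (3 / 4 : ℝ) * Real.exp (-(r * m i))) * ⟪b i, z⟫_ℝ := fun r hr z =>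
    inner_basis_apply_of_apply_basis b (fun j => hK r j hr) z i
  -- the frame curve, the forcing and the nonlinear source along `b i`
  have hyi : ∀ s ∈ Icc (0 : ℝ) τ', ⟪b i, y s⟫_ℝ = ρ * ∫ x, ⟪u (a₀ + s) x, stokesMode k a c x⟫_ℝ := by
    intro s hs
    have h := hSi (y s)
    rw [hy s hs, inner_stateOf_right_of_coe_eq (hus _ (hI s hs)) (hsol.divFree _ (hI s hs)) (hmean _ (hI s hs)) hbi] at h
    rw [h, ← mul_assoc, mul_inv_cancel₀ hρ0, one_mul]
  have hxFi : ⟪b i, xF⟫_ℝ = ρ * ∫ x, ⟪F x, stokesMode k a c x⟫_ℝ := by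
    have h := hSi xF
    rw [hxF, inner_stateOf_right_of_coe_eq hF hFdiv hFmean hbi] at h
    rw [h, ← mul_assoc, mul_inv_cancel₀ hρ0, one_mul]
  have hNi : ∀ s ∈ Icc (0 : ℝ) τ', ⟪b i, Nb (y s) (y s)⟫_ℝ =
      -((m i) ^ (-(3 / 4 : ℝ)) * ρ) * ∫ x, ⟪u (a₀ + s) x, convect (u (a₀ + s)) ⇑(stokesMode k a c) x⟫_ℝ := by
    intro s hs
    rw [real_inner_comm (Nb (y s) (y s)) (b i), hNb (y s) (y s) i k a c hbi, hy s hs, ← hρ]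
    congr 1
    refine integral_congr_ae ?_
    filter_upwards [rep_stateOf (hus _ (hI s hs)) (hsol.divFree _ (hI s hs)) (hmean _ (hI s hs))] with x hx
    simp only [Torus.convect, hx]
  -- `⟪b i, ·⟫` commutes with the Bochner integrals
  have hin : ∀ {f : ℝ → Hsp}, IntervalIntegrable f volume 0 t →
      ⟪b i, ∫ s in (0 : ℝ)..t, f s⟫_ℝ = ∫ s in (0 : ℝ)..t, ⟪b i, f s⟫_ℝ := fun hf => by
    rw [intervalIntegral.integral_of_le ht0, intervalIntegral.integral_of_le ht0]
    exact (integral_inner hf.1 (b i)).symm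
  have hI1' : IntervalIntegrable (fun s => ⟪b i, T (ν * (t - s)) xF⟫_ℝ) volume 0 t :=
    ⟨Integrable.const_inner (b i) hI1.1, Integrable.const_inner (b i) hI1.2⟩
  have hI2' : IntervalIntegrable (fun s => ⟪b i, K (ν * (t - s)) (Nb (y s) (y s))⟫_ℝ) volume 0 t :=
    ⟨Integrable.const_inner (b i) hI2.1, Integrable.const_inner (b i) hI2.2⟩
  -- the modewise Duhamel formula in the window variable `s ↦ a₀ + s`
  have hD := hsol.integral_inner_eq_exp_mul_add_integral hφs hφd heig (hI t ht)
  obtain ⟨G, hG⟩ : ∃ G : ℝ → ℝ, ∀ s, G s = Real.exp (-(ν * stokesEigenvalue k * (a₀ + t - s))) *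
      ((∫ x, ⟪u s x, Torus.convect (u s) ⇑(stokesMode k a c) x⟫_ℝ) + ∫ x, ⟪F x, stokesMode k a c x⟫_ℝ) :=
    ⟨_, fun s => rfl⟩
  have hcv : ∫ s in (0 : ℝ)..t, G (a₀ + s) = ∫ s in a₀..a₀ + t, G s := by
    have h := intervalIntegral.integral_comp_add_left G a₀ (a := 0) (b := t)
    rwa [add_zero] at h
  have hE₀ : Real.exp (-(ν * stokesEigenvalue k * (a₀ + t - a₀))) = Real.exp (-(ν * t * m i)) :=
    congrArg Real.exp (by rw [hmi]; ring)
  have hD' : ∫ x, ⟪u (a₀ + t) x, stokesMode k a c x⟫_ℝ =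
      Real.exp (-(ν * t * m i)) * (∫ x, ⟪u a₀ x, stokesMode k a c x⟫_ℝ) + ∫ s in (0 : ℝ)..t, G (a₀ + s) := by
    rw [hcv, intervalIntegral.integral_congr fun s (_ : s ∈ uIcc a₀ (a₀ + t)) => hG s, ← hE₀]
    exact hD
  -- the Duhamel integrands along `b i`, for a.e. `s ∈ (0, t]`
  have hae : ∀ᵐ s ∂volume, s ∈ uIoc (0 : ℝ) t →
      ⟪b i, T (ν * (t - s)) xF⟫_ℝ - ⟪b i, K (ν * (t - s)) (Nb (y s) (y s))⟫_ℝ = ρ * G (a₀ + s) := by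
    filter_upwards [compl_mem_ae_iff.mpr (Real.volume_singleton (a := t))] with s hst hs
    rw [uIoc_of_le ht0] at hs
    have hlt : s < t := lt_of_le_of_ne hs.2 hst
    have hs' : s ∈ Icc (0 : ℝ) τ' := ⟨hs.1.le, hs.2.trans ht.2⟩
    rw [hTi _ (mul_nonneg hν.le (sub_nonneg.2 hs.2)) xF, hxFi, hKi _ (mul_pos hν (sub_pos.2 hlt)) _, hNi s hs', hG,
      ← hmi]
    have hE : Real.exp (-(ν * m i * (a₀ + t - (a₀ + s)))) = Real.exp (-(ν * (t - s) * m i)) :=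
      congrArg Real.exp (by ring)
    rw [hE]
    linear_combination (Real.exp (-(ν * (t - s) * m i)) * ρ *
      ∫ x, ⟪u (a₀ + s) x, convect (u (a₀ + s)) ⇑(stokesMode k a c) x⟫_ℝ) * hmm
  -- assemble
  have e1 : ⟪b i, y t⟫_ℝ = ρ * ∫ x, ⟪u (a₀ + t) x, stokesMode k a c x⟫_ℝ := hyi t ht
  have e2 : ⟪b i, T (ν * t) (y 0)⟫_ℝ = Real.exp (-(ν * t * m i)) * (ρ * ∫ x, ⟪u a₀ x, stokesMode k a c x⟫_ℝ) := by
    rw [hTi (ν * t) (mul_nonneg hν.le ht0) (y 0), hyi 0 ⟨le_rfl, hτ'.le⟩, add_zero]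
  have e3 : ⟪b i, ∫ s in (0 : ℝ)..t, T (ν * (t - s)) xF⟫_ℝ = ∫ s in (0 : ℝ)..t, ⟪b i, T (ν * (t - s)) xF⟫_ℝ :=
    hin hI1
  have e4 : ⟪b i, ∫ s in (0 : ℝ)..t, K (ν * (t - s)) (Nb (y s) (y s))⟫_ℝ =
      ∫ s in (0 : ℝ)..t, ⟪b i, K (ν * (t - s)) (Nb (y s) (y s))⟫_ℝ := hin hI2
  have e5 : (∫ s in (0 : ℝ)..t, ⟪b i, T (ν * (t - s)) xF⟫_ℝ) - ∫ s in (0 : ℝ)..t, ⟪b i, K (ν * (t - s)) (Nb (y s) (y s))⟫_ℝ =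
      ρ * ∫ s in (0 : ℝ)..t, G (a₀ + s) := by
    rw [← intervalIntegral.integral_sub hI1' hI2', intervalIntegral.integral_congr_ae hae,
      intervalIntegral.integral_const_mul]
  simp only [inner_sub_right (𝕜 := ℝ) (E := Hsp), inner_add_right (𝕜 := ℝ) (E := Hsp), e1, e2, e3, e4]
  linear_combination ρ * hD' - e5


/-! ## The conjugated strong mild identity -/

/-- **Tools stub S5b — THE CONJUGATED STRONG MILD IDENTITY: a classical trajectory, read in the frame `S`, is a mild
solution of S4's equation (block N-R; identification).**  With the mode basis `b`, the frame `S = diag((1+m)^{-1/2})`,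
the Stokes semigroup `T` and smoothing family `K` of S1 and the bilinear form `Nb` of S3 (given through their actions
on the basis / the coefficient formula), let `(u, p)` be a classical solution of NS_ν(F) on `[a₀, a₀+τ'] × T³` with
zero-mean slices, `F` smooth divergence-free mean-zero, and let `y : ℝ → Hsp` be its FRAME CURVE,
`S (y t) = [u(a₀+t)]`, and `x_F` the frame preimage of the force, `S x_F = [F]`.  Then for `t ∈ [0, τ']`:
`y t = T(νt) (y 0) + ∫₀ᵗ T(ν(t−s)) x_F ds − ∫₀ᵗ K(ν(t−s)) Nb(y s, y s) ds` — exactly the mild equation of S4/S4c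
with `T_ν = T(ν·)`, `K_ν = K(ν·)`, forcing `x_F`.  Proof: `y s = S([u] − [Δu])(a₀ + s)` is continuous on the
window (`continuousOn_frameCurve`), so the Duhamel integrands are Bochner integrable
(`intervalIntegrable_duhamelIntegrand` with exponents `0`, `3/4`); along each `b i` the identity is
`inner_basis_frameCurve_eq_inner_basis_mild` (the modewise Duhamel formula, weighted by `(1 + m_i)^{1/2}`), and vectors
with equal basis coefficients are equal (Constantin–Foias 1988, Ch. 5 (5.9)–(5.10), Ch. 6 (6.9)–(6.10)).
[cite: ConstantinFoiasNSE1988, Ch. 5 (5.9)–(5.10)] -/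
theorem stub_conjugatedMildIdentityTools (ι : Type) (b : HilbertBasis ι ℝ Hsp) (m : ι → ℝ) (hpos : ∀ i, 0 < m i)
    (hb : ∀ i, ∃ (k : Fin 3 → ℤ) (a : EuclideanSpace ℝ (Fin 3)) (c : Bool), k ≠ 0 ∧ a ≠ 0 ∧ ⟪latticeVec k, a⟫_ℝ = 0 ∧
      ((b i : Hsp) : Lp (EuclideanSpace ℝ (Fin 3)) 2 (volume : Measure (UnitAddTorus (Fin 3)))) = stokesModeL2 k a c ∧
      m i = stokesEigenvalue k)
    (S : Hsp →L[ℝ] Hsp) (hS : ∀ i, S (b i) = ((1 + m i) ^ (-(1 / 2 : ℝ))) • b i)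
    (T K : ℝ → Hsp →L[ℝ] Hsp) (hT : ∀ t i, 0 ≤ t → T t (b i) = Real.exp (-(t * m i)) • b i) (hTnorm : ∀ t, 0 ≤ t → ‖T t‖ ≤ 1)
    (hTsa : ∀ t, 0 ≤ t → IsSelfAdjoint (T t)) (hTc : ∀ y : Hsp, Continuous fun t : ℝ => T t y)
    (hK : ∀ t i, 0 < t → K t (b i) = ((m i) ^ (3 / 4 : ℝ) * Real.exp (-(t * m i))) • b i)
    (hKnorm : ∀ t, 0 < t → ‖K t‖ ≤ t ^ (-(3 / 4 : ℝ))) (hKc : ∀ y : Hsp, ContinuousOn (fun t : ℝ => K t y) (Ioi 0))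
    (Nb : Hsp →L[ℝ] Hsp →L[ℝ] Hsp)
    (hNb : ∀ (y z : Hsp) (i : ι) (k : Fin 3 → ℤ) (a : EuclideanSpace ℝ (Fin 3)) (c : Bool),
      ((b i : Hsp) : Lp (EuclideanSpace ℝ (Fin 3)) 2 (volume : Measure (UnitAddTorus (Fin 3)))) = stokesModeL2 k a c →
      ⟪Nb y z, b i⟫_ℝ = -((m i) ^ (-(3 / 4 : ℝ)) * (1 + m i) ^ (1 / 2 : ℝ)) *
        ∫ x, ⟪rep (S z) x, convect (rep (S y)) (stokesMode k a c) x⟫_ℝ)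
    {ν : ℝ} (hν : 0 < ν) {F : (UnitAddTorus (Fin 3)) → (EuclideanSpace ℝ (Fin 3))} (hF : IsSmooth F) (hFdiv : IsDivFree F)
    (hFmean : HasZeroMean F) {a₀ τ' : ℝ} (hτ' : 0 < τ')
    {u : ℝ → (UnitAddTorus (Fin 3)) → (EuclideanSpace ℝ (Fin 3))} {p : ℝ → (UnitAddTorus (Fin 3)) → ℝ}
    (hsol : IsClassicalNSSolutionOn (Icc a₀ (a₀ + τ')) ν (fun _ => F) u p) (hmean : ∀ t ∈ Icc a₀ (a₀ + τ'), HasZeroMean (u t))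
    (y : ℝ → Hsp) (hy : ∀ t ∈ Icc (0 : ℝ) τ', S (y t) = stateOf (u (a₀ + t))) (xF : Hsp) (hxF : S xF = stateOf F) :
    ∀ t ∈ Icc (0 : ℝ) τ', y t = T (ν * t) (y 0) + (∫ s in (0 : ℝ)..t, T (ν * (t - s)) xF) -
      ∫ s in (0 : ℝ)..t, K (ν * (t - s)) (Nb (y s) (y s)) := by
  intro t ht
  have ht0 : (0 : ℝ) ≤ t := ht.1
  -- Step 1: the frame curve is continuous on the window; extend it continuously off the window
  have hyc : ContinuousOn y (Icc 0 τ') := continuousOn_frameCurve b hb hS hτ' hsol hmean hy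
  obtain ⟨yx, hyx, hyxeq⟩ : ∃ yx : ℝ → Hsp, Continuous yx ∧ ∀ s ∈ Icc (0 : ℝ) τ', yx s = y s :=
    ⟨IccExtend hτ'.le ((Icc (0 : ℝ) τ').restrict y), (continuousOn_iff_continuous_restrict.1 hyc).Icc_extend',
      fun s hs => IccExtend_of_mem hτ'.le _ hs⟩
  have hg : Continuous fun s => Nb (yx s) (yx s) := Nb.continuous₂.comp₂ hyx hyx
  -- Step 2: both Duhamel integrands are integrable on `[0, t]` (weakly singular kernels `T(ν·)`, exponent `0`, and
  -- `K(ν·)`, exponent `3/4`, applied to continuous sources)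
  have hT' : ∀ r, 0 < r → ‖T (ν * r)‖ ≤ 1 * r ^ (-(0 : ℝ)) := fun r hr => by
    rw [neg_zero, Real.rpow_zero, mul_one]
    exact hTnorm _ (mul_pos hν hr).le
  have hT'c : ∀ z : Hsp, ContinuousOn (fun r : ℝ => T (ν * r) z) (Ioi 0) := fun z =>
    ((hTc z).comp (continuous_const.mul continuous_id)).continuousOn
  have hI1 : IntervalIntegrable (fun s => T (ν * (t - s)) xF) volume 0 t :=
    Literature.Analysis.UnboundedOperators.intervalIntegrable_duhamelIntegrand (K := fun r => T (ν * r)) hT' hT'c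
      zero_lt_one (continuous_const (y := xF)) ht0
  have hK' : ∀ r, 0 < r → ‖K (ν * r)‖ ≤ ν ^ (-(3 / 4 : ℝ)) * r ^ (-(3 / 4 : ℝ)) := fun r hr =>
    (hKnorm (ν * r) (mul_pos hν hr)).trans_eq (Real.mul_rpow hν.le hr.le)
  have hK'c : ∀ z : Hsp, ContinuousOn (fun r : ℝ => K (ν * r) z) (Ioi 0) := fun z =>
    (hKc z).comp (continuous_const.mul continuous_id).continuousOn fun r hr => mul_pos hν hr
  have hI2 : IntervalIntegrable (fun s => K (ν * (t - s)) (Nb (y s) (y s))) volume 0 t := by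
    have h := Literature.Analysis.UnboundedOperators.intervalIntegrable_duhamelIntegrand (K := fun r => K (ν * r))
      hK' hK'c (by norm_num : (3 / 4 : ℝ) < 1) hg ht0
    refine h.congr fun s hs => ?_
    rw [uIoc_of_le ht0] at hs
    show K (ν * (t - s)) (Nb (yx s) (yx s)) = K (ν * (t - s)) (Nb (y s) (y s))
    rw [hyxeq s ⟨hs.1.le, hs.2.trans ht.2⟩]
  -- Step 3: vectors with the same coefficients along the Hilbert basis are equal
  apply b.repr.injective
  ext i
  rw [b.repr_apply_apply, b.repr_apply_apply]
  exact inner_basis_frameCurve_eq_inner_basis_mild b hpos hb hS hT hTsa hK hNb hν hF hFdiv hFmean hτ' hsol hmean hy hxF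
    ht hI1 hI2 i

end Summit.AnomalousDissipation.AnomalousDissipation.Theorems.DenseLoudDesignerForces.Ergodic

end
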